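import Summits.QuantumFields.YangMills.Theorems.FluctuationComparisonRegPrIntLOrganTangentOneBondData
import Summits.QuantumFields.YangMills.Theorems.BalabanUVNodesN09CentralWindowJacobianGraphContinuous
import HarnessLib

/-!
# `FluctuationComparisonRegPrIntLOrganTangentOneBondLaw` — (L7) STAGE 2 BY COMPOSITION: the chart-side data `(Ω, T, T′, θ, jac, M)` of ✓(L5) v2
# `…OrganTangentTriangularChart.regularPackage_of_oneVariableInverseLaws` at `descend`, WITH THE INVERSE CHANGE-OF-VARIABLES LAW `hlaw`, from Stage 1 (✓(L6b)) and pub-ymgap's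
# forward Jacobian law of the one-bond (0.4) map on the central window (✓`BalabanUVNodes.N09CentralWindowJacobianGraphContinuous`, generic torus, here `P := F.P (j+1)`, level `0`, `N := 2`)

Cell `ym3-torus` (rung R3 = continuum `SU(2)` Yang–Mills on T³ — NOT d = 4, NOT infinite volume, NOT a mass gap, NOT Clay), width seat `ym-ust-20520-w5` (gen 21), pen (L7).
`--kind proof --supports stmt-QuantumFields-20520 --as helper`, count-neutral, definition-free; THEOREMS ONLY; nothing printed is asserted.

§1 `restrict_image_eq_map_of_subset` — a forward law `ν⌊ψ(S) = ψ_*(J·μ⌊S)` descends to every measurable sub-window `Ω ⊆ S` with measurable image when `ψ` is injective on `S`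
[folklore].  §2 blindness at the T³ descent in pointwise-agreement form: `eq_extend_of_agree`, `pre_congr_off_private`, `post_congr_off_private`, `descend_update_congr_off_private`.
§3 ★★★ `oneBondLaw`: under ✓(L6b)'s numeric side conditions on `(s, ρ, d₀, ρ″, a)` AND pub-ymgap's window numerics on `α := s + ρ + d₀` (`64α ≤ δ₂`, `157α < L^{−(d−1)}`,
`offCard ĉ∕|Idx| + 150α < 1`), THERE ARE `Ω T T′ θ jac M` with ALL the chart-side binders of (L5) v2 — `hΩm hTm hθm hjm hΩbl hright hlaw hTo hT′T hmargin hΩS hθc hjc hjM` — and of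
`mass_of_smallLift` (`hTo`, `hθc` joint, `hsol`), plus `hjpos`.  `Ω c U := {g | ‖pre·g·post − openHol U ĉ i₀‖ ≤ ρ ∧ K_U g ∈ T c U}` (`K_U g := descend F ℰp j (update U (β c) g) c`),
`jac c U v := (J ĉ U (θ c U v))⁻¹` on `T c U` (`J` = the N09 density), `M := max_c m_c⁻¹` (`m_c` = the uniform floor of `J ĉ` on the compact window graph,
✓`N09TowerOfPerBondChartsOfWindowOpenness.exists_pos_le_density_of_continuousOn_graph`); `hlaw` = N09's forward law on the window ⟶ §1 (sub-window `Ω`, injectivity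
✓`N09CentralWindowAtRecord.avgFun_update_centralBond_injOn_centralWindow`) ⟶ lit ✓`T4TriangularFibredChart.restrict_eq_map_withDensity_of_leftInvOn` (`θ ∘ K = id` on `Ω` = (L6b) ⑭).
NOT HERE: (LIFT) ⟸ (B4), `hmass`, the `σ₀`-side; nothing of (C3)∕VER∘∕(A)∕O1∕20520∕`YM3TorusSU2` is proved.  No `def`, `instance`, `notation`, `sorry`.
-/

set_option autoImplicit false

noncomputable section

namespace Summit.QuantumFields.YangMills.Theorems.FluctuationComparisonRegPrIntLOrganTangentOneBondLaw

open Set Function Filter Topology MeasureTheory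
open scoped ENNReal NNReal Matrix.Norms.L2Operator
open Literature.MathematicalPhysics.QuantumFieldTheory.Balaban1983to89
open Literature.MathematicalPhysics.QuantumFieldTheory.Balaban1983to89.T3OrbitAverage
open T3ContinuumYM3Torus T3NestedUnitLaws T3UnitLawDensityEML T3LevelShift T4Continuum AveragingRT BlockAveraging
open Literature.MathematicalPhysics.QuantumFieldTheory.Balaban1983to89.BlockAveragingHaarAC
  (centralBond openHol IsCentral pre post axialAvg_eq_pre_mul_mul_post)
open Literature.MathematicalPhysics.QuantumFieldTheory.Balaban1983to89.BlockAveragingEMLHaarAC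
  (fibreFamily offCard fibreFamily_of_isCentral dist1_fibreFamily_of_not_isCentral)
open Literature.MathematicalPhysics.QuantumFieldTheory.Balaban1983to89.T4TriangularPushforward (IsLocal)
open ExpMeanLog (expMeanLogSU deltaSU)
open Summit.QuantumFields.YangMills.Theorems.OrganTangentTriangularChart (isLocal_descend injective_private)
open Summit.QuantumFields.YangMills.Theorems.FluctuationComparisonRegPrIntLOrganTangentOneBondAtDescend
  (level_ok descend_apply descend_update_private_eq descend_update_private_eq_fibreMap openHol_congr_off_private small_is_good)
open Summit.QuantumFields.YangMills.Theorems.FluctuationComparisonRegPrIntLOrganTangentOneBondData (oneBondData continuous_openHol_pre_post)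
open Summit.QuantumFields.YangMills.BalabanUVNodes.N09CentralWindowChart (norm_coe_mul_star_sub_one)
open Summit.QuantumFields.YangMills.BalabanUVNodes.N09CentralWindowAtRecord (avgFun_update_centralBond_injOn_centralWindow measurableSet_centralWindow)
open Summit.QuantumFields.YangMills.BalabanUVNodes.N09CentralWindowJacobianGraphContinuous (exists_jacobian_forwardLaws_continuousOn_graph)
open Summit.QuantumFields.YangMills.BalabanUVNodes.N09TowerOfPerBondChartsOfWindowOpenness (exists_pos_le_density_of_continuousOn_graph)

/-! ## §1 A forward law descends to injective sub-windows -/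

/-- **A FORWARD LAW DESCENDS TO SUB-WINDOWS**: if `ν⌊ψ(S) = ψ_*(J·μ⌊S)`, `ψ` is injective on `S` and measurable, and `Ω ⊆ S` is measurable with measurable image,
then `ν⌊ψ(Ω) = ψ_*(J·μ⌊Ω)`. [folklore] -/
theorem restrict_image_eq_map_of_subset {X Y : Type*} [MeasurableSpace X] [MeasurableSpace Y] {μ : Measure X} {ν : Measure Y}
    {S Ω : Set X} (hΩS : Ω ⊆ S) {ψ : X → Y} (hψ : Measurable ψ) (hinj : InjOn ψ S) (hψΩ : MeasurableSet (ψ '' Ω))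
    {J : X → ℝ≥0∞} (hlaw : ν.restrict (ψ '' S) = ((μ.restrict S).withDensity J).map ψ) :
    ν.restrict (ψ '' Ω) = ((μ.restrict Ω).withDensity J).map ψ := by
  refine Measure.ext fun A hA => ?_
  have hsub : ψ '' Ω ⊆ ψ '' S := image_mono hΩS
  have hset : ψ ⁻¹' (A ∩ ψ '' Ω) ∩ S = ψ ⁻¹' A ∩ Ω := by
    ext x
    refine ⟨fun hx => ⟨hx.1.1, ?_⟩, fun hx => ⟨⟨hx.1, mem_image_of_mem ψ hx.2⟩, hΩS hx.2⟩⟩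
    obtain ⟨y, hy, hyx⟩ := hx.1.2
    rwa [← hinj (hΩS hy) hx.2 hyx]
  have h1 : ν.restrict (ψ '' Ω) A = ν.restrict (ψ '' S) (A ∩ ψ '' Ω) := by
    rw [Measure.restrict_apply hA, Measure.restrict_apply (hA.inter hψΩ), inter_assoc, inter_eq_left.2 hsub]
  rw [h1, hlaw, Measure.map_apply hψ (hA.inter hψΩ), Measure.map_apply hψ hA, withDensity_apply _ ((hA.inter hψΩ).preimage hψ),
    withDensity_apply _ (hA.preimage hψ), Measure.restrict_restrict ((hA.inter hψΩ).preimage hψ), Measure.restrict_restrict (hA.preimage hψ), hset]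

/-- **THE INVERSE LAW ON A SUB-WINDOW FROM THE FORWARD LAW ON THE WINDOW**: `ψ` injective on `S` with forward law `ν⌊ψ(S) = ψ_*(J·μ⌊S)` (`J` measurable,
non-vanishing on `Ω`), `Ω ⊆ S` measurable with `ψ(Ω) = T` measurable, `θ` measurable with `θ ∘ ψ = id` on `Ω`, and `jac = (J ∘ θ)⁻¹` on `T` ⇒
`μ⌊Ω = θ_*(jac · ν⌊T)`. [folklore] -/
theorem inverseLaw_of_forwardLaw {X Y : Type*} [MeasurableSpace X] [MeasurableSpace Y] {μ : Measure X} {ν : Measure Y}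
    {S Ω : Set X} {T : Set Y} (hΩS : Ω ⊆ S) (hΩ : MeasurableSet Ω) (hT : MeasurableSet T) {ψ : X → Y} (hψ : Measurable ψ) (hinj : InjOn ψ S)
    {θ : Y → X} (hθ : Measurable θ) (hKΩ : ψ '' Ω = T) (hinv : ∀ x ∈ Ω, θ (ψ x) = x)
    {J : X → ℝ≥0} (hJm : Measurable J) (hJ0 : ∀ x ∈ Ω, J x ≠ 0)
    (hfwd : ν.restrict (ψ '' S) = ((μ.restrict S).withDensity fun x => (J x : ℝ≥0∞)).map ψ)
    {jac : Y → ℝ≥0} (hjac : ∀ y ∈ T, jac y = (J (θ y))⁻¹) :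
    μ.restrict Ω = ((ν.restrict T).withDensity fun y => (jac y : ℝ≥0∞)).map θ := by
  have hfwdΩ := restrict_image_eq_map_of_subset hΩS hψ hinj (hKΩ ▸ hT) hfwd
  have hJm' : Measurable fun x => (J x : ℝ≥0∞) := measurable_coe_nnreal_ennreal.fun_comp hJm
  have hinvlaw := T4TriangularFibredChart.restrict_eq_map_withDensity_of_leftInvOn (ν := ν) (jac := fun x => (J x : ℝ≥0∞)) hΩ hψ hθ hinv hJm'
    (fun x hx => ENNReal.coe_ne_zero.2 (hJ0 x hx)) (fun x _ => ENNReal.coe_ne_top) hfwdΩ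
  rw [hinvlaw, hKΩ]
  congr 1
  refine withDensity_congr_ae ?_
  filter_upwards [ae_restrict_mem hT] with y hy
  have hθy : θ y ∈ Ω := by
    obtain ⟨x, hx, rfl⟩ := (hKΩ.symm ▸ hy : y ∈ ψ '' Ω)
    rwa [hinv x hx]
  rw [hjac y hy, ENNReal.coe_inv (hJ0 _ hθy)]

/-! ## §2 Blindness to the private coordinates, pointwise-agreement form -/

/-- A field agreeing with `U` off the private bonds IS the resampling `extend β (U′ ∘ β) U`. [folklore] -/
theorem eq_extend_of_agree (F : T3Family) (j : ℕ) {U U' : GaugeField (F.P (j + 1)) 0 ↥(Matrix.specialUnitaryGroup (Fin 2) ℂ)}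
    (hU' : ∀ b : PBond (F.P (j + 1)) 0, (¬ ∃ c' : PBond (F.P j) 0, centralBond (bondShift (sitesPerDir_descend F j 0) c') = b) → U' b = U b) :
    U' = extend (fun c' : PBond (F.P j) 0 => centralBond (bondShift (sitesPerDir_descend F j 0) c')) (fun c' => U' (centralBond (bondShift (sitesPerDir_descend F j 0) c'))) U := by
  funext b
  by_cases hb : ∃ c' : PBond (F.P j) 0, centralBond (bondShift (sitesPerDir_descend F j 0) c') = b
  · obtain ⟨c', rfl⟩ := hb
    exact ((injective_private F j).extend_apply (fun c' => U' (centralBond (bondShift (sitesPerDir_descend F j 0) c'))) U c').symm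
  · rw [extend_apply' _ _ _ hb]; exact hU' b hb

/-- `pre` and `post` at `ĉ` are blind to all private coordinates. [cite: Balaban1987RG1, (0.4) p.253 (bookkeeping)] -/
theorem pre_post_congr_off_private (F : T3Family) (j : ℕ) {U U' : GaugeField (F.P (j + 1)) 0 ↥(Matrix.specialUnitaryGroup (Fin 2) ℂ)}
    (hU' : ∀ b : PBond (F.P (j + 1)) 0, (¬ ∃ c' : PBond (F.P j) 0, centralBond (bondShift (sitesPerDir_descend F j 0) c') = b) → U' b = U b) (c : PBond (F.P j) 0) :
    pre U' (bondShift (sitesPerDir_descend F j 0) c) = pre U (bondShift (sitesPerDir_descend F j 0) c) ∧ post U' (bondShift (sitesPerDir_descend F j 0) c) = post U (bondShift (sitesPerDir_descend F j 0) c) := by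
  rw [eq_extend_of_agree F j hU']
  exact ⟨BlockAveragingCentralBlind.apply_extend_eq_of_forall_update (Q := fun V : GaugeField (F.P (j + 1)) 0 ↥(Matrix.specialUnitaryGroup (Fin 2) ℂ) => pre V (bondShift (sitesPerDir_descend F j 0) c)) (injective_private F j)
      (fun V c' x => BlockAveragingCentralBlind.pre_update_centralBond_any (level_ok F j) V (bondShift (sitesPerDir_descend F j 0) c) (bondShift (sitesPerDir_descend F j 0) c') x) U _,
    BlockAveragingCentralBlind.apply_extend_eq_of_forall_update (Q := fun V : GaugeField (F.P (j + 1)) 0 ↥(Matrix.specialUnitaryGroup (Fin 2) ℂ) => post V (bondShift (sitesPerDir_descend F j 0) c)) (injective_private F j)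
      (fun V c' x => BlockAveragingCentralBlind.post_update_centralBond_any (level_ok F j) V (bondShift (sitesPerDir_descend F j 0) c) (bondShift (sitesPerDir_descend F j 0) c') x) U _⟩

/-- The W-coordinate family at `ĉ` is blind to all private coordinates (off-central `openHol`, ✓`openHol_congr_off_private`; central entries are `1`).
[cite: Balaban1987RG1, (0.4) p.253 (bookkeeping)] -/
theorem fibreFamily_congr_off_private (F : T3Family) (j : ℕ) {U U' : GaugeField (F.P (j + 1)) 0 ↥(Matrix.specialUnitaryGroup (Fin 2) ℂ)}
    (hU' : ∀ b : PBond (F.P (j + 1)) 0, (¬ ∃ c' : PBond (F.P j) 0, centralBond (bondShift (sitesPerDir_descend F j 0) c') = b) → U' b = U b) (c : PBond (F.P j) 0) :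
    fibreFamily U' (bondShift (sitesPerDir_descend F j 0) c) = fibreFamily U (bondShift (sitesPerDir_descend F j 0) c) := by
  funext W i
  unfold fibreFamily
  split_ifs with hi
  · rfl
  · rw [openHol_congr_off_private F j U U' c i hi hU']

/-- The one-bond map `g ↦ descend F ℰp j (update U (β c) g) c` is blind to the OTHER private coordinates: it is the fibre map of the blind family at the
blind argument `pre·g·post` (✓`descend_update_private_eq_fibreMap`). [cite: Balaban1987RG1, (0.4) p.253 (bookkeeping)] -/
theorem descend_update_congr_off_private (F : T3Family) (j : ℕ) {U U' : GaugeField (F.P (j + 1)) 0 ↥(Matrix.specialUnitaryGroup (Fin 2) ℂ)}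
    (hU' : ∀ b : PBond (F.P (j + 1)) 0, (¬ ∃ c' : PBond (F.P j) 0, centralBond (bondShift (sitesPerDir_descend F j 0) c') = b) → U' b = U b) (c : PBond (F.P j) 0) (g : ↥(Matrix.specialUnitaryGroup (Fin 2) ℂ)) :
    descend F ℰp j (update U' (centralBond (bondShift (sitesPerDir_descend F j 0) c)) g) c = descend F ℰp j (update U (centralBond (bondShift (sitesPerDir_descend F j 0) c)) g) c := by
  obtain ⟨hpre, hpost⟩ := pre_post_congr_off_private F j hU' c
  rw [descend_update_private_eq_fibreMap, descend_update_private_eq_fibreMap, hpre, hpost]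
  unfold BlockAveragingEMLHaarAC.fibreMap BlockAveragingEMLHaarAC.FibreSmall
  rw [fibreFamily_congr_off_private F j hU' c]

/-! ## §3 The package with the law -/

/-- ★★★ **STAGE 2 — THE PER-BOND DATA OF THE TRIANGULAR CHART AT `descend` WITH THE INVERSE CHANGE-OF-VARIABLES LAW** (see the module docstring).
[cite: Balaban1987RG1, (0.4) p.253, (2.4) p.266 and (2.10) p.267; Helgason2000, Ch. I §1 Thm. 1.14 (13) p.96] -/
theorem oneBondLaw (F : T3Family) (j : ℕ) (i₀ : Idx (F.P (j + 1)))
    (hi₀ : ∀ c : PBond (F.P j) 0, ¬ IsCentral (bondShift (sitesPerDir_descend F j 0) c) i₀) {s ρ d₀ ρ'' a : ℝ}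
    (hs0 : 0 < s) (hρ0 : 0 ≤ ρ) (hd0 : 0 < d₀) (hr : s + ρ + d₀ ≤ 1 / 24) (hrδ : s + ρ + d₀ < deltaSU (Fin 2))
    (hq : ∀ c : PBond (F.P j) 0, ((Finset.univ.filter fun i => ¬ IsCentral (bondShift (sitesPerDir_descend F j 0) c) i).card : ℝ) /
        (Fintype.card (Idx (F.P (j + 1))) : ℝ) + 144 * (s + ρ + d₀) < 1)
    (hρ'' : 0 < ρ'') (hρ''le : ∀ c : PBond (F.P j) 0, ρ'' ≤ ρ - (((Finset.univ.filter fun i => ¬ IsCentral (bondShift (sitesPerDir_descend F j 0) c) i).card : ℝ) /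
        (Fintype.card (Idx (F.P (j + 1))) : ℝ) * (s + ρ) + 36 * (s + ρ) ^ 2))
    (ha : 0 ≤ a) (hta : (((((F.P (j + 1)).d + 2) * (F.P (j + 1)).L : ℕ) : ℝ) ^ 2 / 4) * a < deltaSU (Fin 2))
    (h2t : 2 * ((((((F.P (j + 1)).d + 2) * (F.P (j + 1)).L : ℕ) : ℝ) ^ 2 / 4) * a) < s)
    (htρ : (((((F.P (j + 1)).d + 2) * (F.P (j + 1)).L : ℕ) : ℝ) ^ 2 / 4) * a ≤ ρ)
    (h7t : 7 * ((((((F.P (j + 1)).d + 2) * (F.P (j + 1)).L : ℕ) : ℝ) ^ 2 / 4) * a) < ρ'' / 2)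
    (hα64 : 64 * (s + ρ + d₀) ≤ deltaSU (Fin 2)) (hαL : 157 * (s + ρ + d₀) < (((F.P (j + 1)).L : ℝ) ^ ((F.P (j + 1)).d - 1))⁻¹)
    (hgap : ∀ c : PBond (F.P j) 0, (offCard (bondShift (sitesPerDir_descend F j 0) c) : ℝ) / (Fintype.card (Idx (F.P (j + 1))) : ℝ) + 150 * (s + ρ + d₀) < 1) :
    ∃ (Ω T T' : PBond (F.P j) 0 → GaugeField (F.P (j + 1)) 0 ↥(Matrix.specialUnitaryGroup (Fin 2) ℂ) → Set ↥(Matrix.specialUnitaryGroup (Fin 2) ℂ))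
      (θ : PBond (F.P j) 0 → GaugeField (F.P (j + 1)) 0 ↥(Matrix.specialUnitaryGroup (Fin 2) ℂ) →
        ↥(Matrix.specialUnitaryGroup (Fin 2) ℂ) → ↥(Matrix.specialUnitaryGroup (Fin 2) ℂ))
      (jac : PBond (F.P j) 0 → GaugeField (F.P (j + 1)) 0 ↥(Matrix.specialUnitaryGroup (Fin 2) ℂ) → ↥(Matrix.specialUnitaryGroup (Fin 2) ℂ) → ℝ≥0) (M : ℝ≥0),
      -- measurability (hΩm hTm hθm hjm)
      (∀ c, MeasurableSet {p : GaugeField (F.P (j + 1)) 0 ↥(Matrix.specialUnitaryGroup (Fin 2) ℂ) × ↥(Matrix.specialUnitaryGroup (Fin 2) ℂ) | p.2 ∈ Ω c p.1}) ∧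
      (∀ c, MeasurableSet {p : GaugeField (F.P (j + 1)) 0 ↥(Matrix.specialUnitaryGroup (Fin 2) ℂ) × ↥(Matrix.specialUnitaryGroup (Fin 2) ℂ) | p.2 ∈ T c p.1}) ∧
      (∀ c, Measurable fun p : GaugeField (F.P (j + 1)) 0 ↥(Matrix.specialUnitaryGroup (Fin 2) ℂ) × ↥(Matrix.specialUnitaryGroup (Fin 2) ℂ) => θ c p.1 p.2) ∧
      (∀ c, Measurable fun p : GaugeField (F.P (j + 1)) 0 ↥(Matrix.specialUnitaryGroup (Fin 2) ℂ) × ↥(Matrix.specialUnitaryGroup (Fin 2) ℂ) => jac c p.1 p.2) ∧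
      -- blindness of the fine domain (hΩbl)
      (∀ c (U : GaugeField (F.P (j + 1)) 0 ↥(Matrix.specialUnitaryGroup (Fin 2) ℂ)) (g : PBond (F.P j) 0 → ↥(Matrix.specialUnitaryGroup (Fin 2) ℂ)),
        Ω c (extend (fun c : PBond (F.P j) 0 => centralBond (bondShift (sitesPerDir_descend F j 0) c)) g U) = Ω c U) ∧
      -- right inverse (hright) and THE LAW (hlaw)
      (∀ c U, ∀ v ∈ T c U, descend F ℰp j (update U (centralBond (bondShift (sitesPerDir_descend F j 0) c)) (θ c U v)) c = v) ∧
      (∀ c U, (HaarData.haar : Measure ↥(Matrix.specialUnitaryGroup (Fin 2) ℂ)).restrict (Ω c U) =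
        (((HaarData.haar : Measure ↥(Matrix.specialUnitaryGroup (Fin 2) ℂ)).restrict (T c U)).withDensity fun v => (jac c U v : ℝ≥0∞)).map (θ c U)) ∧
      -- topology (hTo hT′T) and the margin
      (∀ c U, IsOpen (T c U)) ∧ (∀ c U, closure (T' c U) ⊆ T c U) ∧
      (∀ (U : GaugeField (F.P (j + 1)) 0 ↥(Matrix.specialUnitaryGroup (Fin 2) ℂ)) (V : GaugeField (F.P j) 0 ↥(Matrix.specialUnitaryGroup (Fin 2) ℂ)),
        (∀ c, V c ∈ T c U) → PlaqSmall a (extend (fun c : PBond (F.P j) 0 => centralBond (bondShift (sitesPerDir_descend F j 0) c)) (fun c => θ c U (V c)) U) → ∀ c, V c ∈ T' c U) ∧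
      -- small fields (hΩS), continuity (hθc hjc), the uniform bound (hjM)
      (∀ U : GaugeField (F.P (j + 1)) 0 ↥(Matrix.specialUnitaryGroup (Fin 2) ℂ), PlaqSmall a U → ∀ c, U (centralBond (bondShift (sitesPerDir_descend F j 0) c)) ∈ Ω c U) ∧
      (∀ c U, ContinuousOn (θ c U) (T c U)) ∧
      (∀ c U, ContinuousOn (fun v => (jac c U v : ℝ)) (T c U)) ∧
      (∀ c U v, jac c U v ≤ M) ∧
      -- the `mass_of_smallLift` letters (hTo, hθc joint; hsol) and positivity of the Jacobian on `T`
      (∀ c, IsOpen {p : GaugeField (F.P (j + 1)) 0 ↥(Matrix.specialUnitaryGroup (Fin 2) ℂ) × ↥(Matrix.specialUnitaryGroup (Fin 2) ℂ) | p.2 ∈ T c p.1}) ∧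
      (∀ c, ContinuousOn (fun p : GaugeField (F.P (j + 1)) 0 ↥(Matrix.specialUnitaryGroup (Fin 2) ℂ) × ↥(Matrix.specialUnitaryGroup (Fin 2) ℂ) =>
        θ c p.1 p.2) {p | p.2 ∈ T c p.1}) ∧
      (∀ U : GaugeField (F.P (j + 1)) 0 ↥(Matrix.specialUnitaryGroup (Fin 2) ℂ), PlaqSmall a U →
        ∀ c, descend F ℰp j U c ∈ T' c U ∧ θ c U (descend F ℰp j U c) = U (centralBond (bondShift (sitesPerDir_descend F j 0) c))) ∧
      (∀ c U, ∀ v ∈ T c U, jac c U v ≠ 0) := by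
  classical
  have ht0 : 0 ≤ (((((F.P (j + 1)).d + 2) * (F.P (j + 1)).L : ℕ) : ℝ) ^ 2 / 4) * a := by positivity
  have hα0 : 0 ≤ s + ρ + d₀ := by linarith
  -- Stage 1 (L6b)
  obtain ⟨T, T', θ, hTo, hToj, hT'T, hright, hregj, hreg, hsol, hmargin, hTm, hT'm, hθm, hblind, hwin, hlinv⟩ :=
    oneBondData F j i₀ hi₀ hs0 hρ0 hd0 hr hrδ hq hρ'' hρ''le ha hta h2t htρ h7t
  -- the forward Jacobian law on the central `α`-window (pub-ymgap N09), read at `P := F.P (j+1)`, level `0`, `N := 2`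
  have hgap' : ∀ c' : PBond (F.P (j + 1)) (0 + 1), (offCard c' : ℝ) / (Fintype.card (Idx (F.P (j + 1))) : ℝ) + 150 * (s + ρ + d₀) < 1 := by
    intro c'
    have h := hgap ((bondShift (sitesPerDir_descend F j 0)).symm c')
    rwa [Equiv.apply_symm_apply] at h
  obtain ⟨J, hJm, hJ0, hfwd, hJc, hJcg⟩ := exists_jacobian_forwardLaws_continuousOn_graph (P := F.P (j + 1)) (j := 0) (N := 2)
    (level_ok F j) hα0 hr hα64 hαL hgap'
  have hfloor := fun c : PBond (F.P j) 0 =>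
    exists_pos_le_density_of_continuousOn_graph (N := 2) (bondShift (sitesPerDir_descend F j 0) c) (s + ρ + d₀) (J (bondShift (sitesPerDir_descend F j 0) c)) (hJcg (bondShift (sitesPerDir_descend F j 0) c)) (hJ0 (bondShift (sitesPerDir_descend F j 0) c))
  choose m hm0 hmle using hfloor
  -- the one-bond map, jointly measurable
  have hψm : ∀ c : PBond (F.P j) 0, Measurable fun p : GaugeField (F.P (j + 1)) 0 ↥(Matrix.specialUnitaryGroup (Fin 2) ℂ) × ↥(Matrix.specialUnitaryGroup (Fin 2) ℂ) =>
      descend F ℰp j (update p.1 (centralBond (bondShift (sitesPerDir_descend F j 0) c)) p.2) c := fun c =>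
    (measurable_pi_apply c).fun_comp ((measurable_descend F ℰp measurableE_ℰp j).fun_comp (measurable_update' (a := centralBond (bondShift (sitesPerDir_descend F j 0) c))))
  have hψU : ∀ (c : PBond (F.P j) 0) (U : GaugeField (F.P (j + 1)) 0 ↥(Matrix.specialUnitaryGroup (Fin 2) ℂ)),
      Measurable fun g : ↥(Matrix.specialUnitaryGroup (Fin 2) ℂ) => descend F ℰp j (update U (centralBond (bondShift (sitesPerDir_descend F j 0) c)) g) c := fun c U =>
    (measurable_pi_apply c).fun_comp ((measurable_descend F ℰp measurableE_ℰp j).fun_comp (measurable_update U))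
  -- pub-ymgap's injectivity and forward law, read in `descend` form (✓`descend_apply`, a syntactic rewrite)
  have hinjU : ∀ (c : PBond (F.P j) 0) (U : GaugeField (F.P (j + 1)) 0 ↥(Matrix.specialUnitaryGroup (Fin 2) ℂ)),
      InjOn (fun g : ↥(Matrix.specialUnitaryGroup (Fin 2) ℂ) => descend F ℰp j (update U (centralBond (bondShift (sitesPerDir_descend F j 0) c)) g) c)
        {g | ∀ i : Idx (F.P (j + 1)), dist1 (fibreFamily U (bondShift (sitesPerDir_descend F j 0) c) (pre U (bondShift (sitesPerDir_descend F j 0) c) * g * post U (bondShift (sitesPerDir_descend F j 0) c)) i) ≤ s + ρ + d₀} := by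
    intro c U
    have h := avgFun_update_centralBond_injOn_centralWindow (N := 2) (level_ok F j) U (bondShift (sitesPerDir_descend F j 0) c) hα0 hr hrδ (hgap' (bondShift (sitesPerDir_descend F j 0) c))
    simp only [← descend_apply] at h
    exact h
  have hfwdU : ∀ (c : PBond (F.P j) 0) (U : GaugeField (F.P (j + 1)) 0 ↥(Matrix.specialUnitaryGroup (Fin 2) ℂ)),
      (HaarData.haar : Measure ↥(Matrix.specialUnitaryGroup (Fin 2) ℂ)).restrict
          ((fun g : ↥(Matrix.specialUnitaryGroup (Fin 2) ℂ) => descend F ℰp j (update U (centralBond (bondShift (sitesPerDir_descend F j 0) c)) g) c) ''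
            {g | ∀ i : Idx (F.P (j + 1)), dist1 (fibreFamily U (bondShift (sitesPerDir_descend F j 0) c) (pre U (bondShift (sitesPerDir_descend F j 0) c) * g * post U (bondShift (sitesPerDir_descend F j 0) c)) i) ≤ s + ρ + d₀}) =
        (((HaarData.haar : Measure ↥(Matrix.specialUnitaryGroup (Fin 2) ℂ)).restrict
          {g | ∀ i : Idx (F.P (j + 1)), dist1 (fibreFamily U (bondShift (sitesPerDir_descend F j 0) c) (pre U (bondShift (sitesPerDir_descend F j 0) c) * g * post U (bondShift (sitesPerDir_descend F j 0) c)) i) ≤ s + ρ + d₀}).withDensity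
            fun g => (J (bondShift (sitesPerDir_descend F j 0) c) U g : ℝ≥0∞)).map (fun g : ↥(Matrix.specialUnitaryGroup (Fin 2) ℂ) => descend F ℰp j (update U (centralBond (bondShift (sitesPerDir_descend F j 0) c)) g) c) := by
    intro c U
    have h := hfwd (bondShift (sitesPerDir_descend F j 0) c) U
    simp only [← descend_apply] at h
    exact h
  -- the witnesses `Ω`, `jac`, `M`
  obtain ⟨Ω, hΩ⟩ : ∃ Ω : PBond (F.P j) 0 → GaugeField (F.P (j + 1)) 0 ↥(Matrix.specialUnitaryGroup (Fin 2) ℂ) → Set ↥(Matrix.specialUnitaryGroup (Fin 2) ℂ),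
      ∀ c U g, g ∈ Ω c U ↔ (‖((pre U (bondShift (sitesPerDir_descend F j 0) c) * g * post U (bondShift (sitesPerDir_descend F j 0) c) : ↥(Matrix.specialUnitaryGroup (Fin 2) ℂ)) : Matrix (Fin 2) (Fin 2) ℂ) -
        ((openHol U (bondShift (sitesPerDir_descend F j 0) c) i₀ : ↥(Matrix.specialUnitaryGroup (Fin 2) ℂ)) : Matrix (Fin 2) (Fin 2) ℂ)‖ ≤ ρ ∧
        descend F ℰp j (update U (centralBond (bondShift (sitesPerDir_descend F j 0) c)) g) c ∈ T c U) :=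
    ⟨fun c U => {g | ‖((pre U (bondShift (sitesPerDir_descend F j 0) c) * g * post U (bondShift (sitesPerDir_descend F j 0) c) : ↥(Matrix.specialUnitaryGroup (Fin 2) ℂ)) : Matrix (Fin 2) (Fin 2) ℂ) -
        ((openHol U (bondShift (sitesPerDir_descend F j 0) c) i₀ : ↥(Matrix.specialUnitaryGroup (Fin 2) ℂ)) : Matrix (Fin 2) (Fin 2) ℂ)‖ ≤ ρ ∧
        descend F ℰp j (update U (centralBond (bondShift (sitesPerDir_descend F j 0) c)) g) c ∈ T c U}, fun _ _ _ => Iff.rfl⟩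
  obtain ⟨jac, hjac⟩ : ∃ jac : PBond (F.P j) 0 → GaugeField (F.P (j + 1)) 0 ↥(Matrix.specialUnitaryGroup (Fin 2) ℂ) → ↥(Matrix.specialUnitaryGroup (Fin 2) ℂ) → ℝ≥0,
      ∀ c U v, jac c U v = if v ∈ T c U then (J (bondShift (sitesPerDir_descend F j 0) c) U (θ c U v))⁻¹ else 0 :=
    ⟨fun c U v => if v ∈ T c U then (J (bondShift (sitesPerDir_descend F j 0) c) U (θ c U v))⁻¹ else 0, fun _ _ _ => rfl⟩
  -- FACTS.  (a) the window of a preimage; (b) `Ω ⊆` window; (c) `θ(T) ⊆ Ω`; (d) `K(Ω) = T`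
  have hwinθ : ∀ c U, ∀ v ∈ T c U, ∀ i : Idx (F.P (j + 1)),
      dist1 (fibreFamily U (bondShift (sitesPerDir_descend F j 0) c) (pre U (bondShift (sitesPerDir_descend F j 0) c) * θ c U v * post U (bondShift (sitesPerDir_descend F j 0) c)) i) ≤ s + ρ + d₀ := by
    intro c U v hv i
    by_cases hi : IsCentral (bondShift (sitesPerDir_descend F j 0) c) i
    · rw [fibreFamily_of_isCentral _ _ _ i hi, GaugeGroup.dist1_one]; exact hα0
    · rw [dist1_fibreFamily_of_not_isCentral _ _ _ i hi, norm_coe_mul_star_sub_one]; exact (hwin c U v hv).2 i hi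
  have hΩwin : ∀ c U, ∀ g ∈ Ω c U, ∀ i : Idx (F.P (j + 1)), dist1 (fibreFamily U (bondShift (sitesPerDir_descend F j 0) c) (pre U (bondShift (sitesPerDir_descend F j 0) c) * g * post U (bondShift (sitesPerDir_descend F j 0) c)) i) ≤ s + ρ + d₀ := by
    intro c U g hg
    obtain ⟨hball, hT⟩ := (hΩ c U g).1 hg
    have h := hwinθ c U _ hT
    rwa [hlinv c U g hball hT] at h
  have hθΩ : ∀ c U, ∀ v ∈ T c U, θ c U v ∈ Ω c U := fun c U v hv =>
    (hΩ c U _).2 ⟨(hwin c U v hv).1, by rw [hright c U v hv]; exact hv⟩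
  have hKΩ : ∀ c U, (fun g => descend F ℰp j (update U (centralBond (bondShift (sitesPerDir_descend F j 0) c)) g) c) '' Ω c U = T c U := by
    intro c U
    refine Subset.antisymm (fun v ⟨g, hg, hgv⟩ => hgv ▸ ((hΩ c U g).1 hg).2) fun v hv => ⟨θ c U v, hθΩ c U v hv, hright c U v hv⟩
  -- (e) the LAW on `Ω`: forward law on the window ⟶ sub-window `Ω` ⟶ inverse law through `θ ∘ K = id` (§1)
  have hΩmU : ∀ c U, MeasurableSet (Ω c U) := by
    intro c U
    have h1 : IsClosed {g : ↥(Matrix.specialUnitaryGroup (Fin 2) ℂ) |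
        ‖((pre U (bondShift (sitesPerDir_descend F j 0) c) * g * post U (bondShift (sitesPerDir_descend F j 0) c) : ↥(Matrix.specialUnitaryGroup (Fin 2) ℂ)) : Matrix (Fin 2) (Fin 2) ℂ) -
          ((openHol U (bondShift (sitesPerDir_descend F j 0) c) i₀ : ↥(Matrix.specialUnitaryGroup (Fin 2) ℂ)) : Matrix (Fin 2) (Fin 2) ℂ)‖ ≤ ρ} :=
      isClosed_le ((continuous_subtype_val.comp ((continuous_const.mul continuous_id).mul continuous_const)).sub continuous_const).norm
        continuous_const
    have h2 : MeasurableSet ((fun g => descend F ℰp j (update U (centralBond (bondShift (sitesPerDir_descend F j 0) c)) g) c) ⁻¹' T c U) := (hTo c U).measurableSet.preimage (hψU c U)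
    have hset : Ω c U = {g : ↥(Matrix.specialUnitaryGroup (Fin 2) ℂ) |
        ‖((pre U (bondShift (sitesPerDir_descend F j 0) c) * g * post U (bondShift (sitesPerDir_descend F j 0) c) : ↥(Matrix.specialUnitaryGroup (Fin 2) ℂ)) : Matrix (Fin 2) (Fin 2) ℂ) -
          ((openHol U (bondShift (sitesPerDir_descend F j 0) c) i₀ : ↥(Matrix.specialUnitaryGroup (Fin 2) ℂ)) : Matrix (Fin 2) (Fin 2) ℂ)‖ ≤ ρ} ∩
        ((fun g => descend F ℰp j (update U (centralBond (bondShift (sitesPerDir_descend F j 0) c)) g) c) ⁻¹' T c U) := Set.ext fun g => hΩ c U g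
    rw [hset]; exact h1.measurableSet.inter h2
  have hlaw : ∀ c U, (HaarData.haar : Measure ↥(Matrix.specialUnitaryGroup (Fin 2) ℂ)).restrict (Ω c U) =
      (((HaarData.haar : Measure ↥(Matrix.specialUnitaryGroup (Fin 2) ℂ)).restrict (T c U)).withDensity fun v => (jac c U v : ℝ≥0∞)).map (θ c U) :=
    fun c U => inverseLaw_of_forwardLaw (ψ := fun g : ↥(Matrix.specialUnitaryGroup (Fin 2) ℂ) => descend F ℰp j (update U (centralBond (bondShift (sitesPerDir_descend F j 0) c)) g) c)
      (θ := θ c U) (J := J (bondShift (sitesPerDir_descend F j 0) c) U) (jac := jac c U)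
      (fun g hg => hΩwin c U g hg) (hΩmU c U) (hTo c U).measurableSet (hψU c U) (hinjU c U)
      ((hθm c).fun_comp (measurable_const.prodMk measurable_id)) (hKΩ c U) (fun g hg => hlinv c U g ((hΩ c U g).1 hg).1 ((hΩ c U g).1 hg).2)
      ((hJm (bondShift (sitesPerDir_descend F j 0) c)).fun_comp (measurable_const.prodMk measurable_id)) (fun g hg => hJ0 (bondShift (sitesPerDir_descend F j 0) c) U g (hΩwin c U g hg)) (hfwdU c U)
      (fun v hv => by rw [hjac, if_pos hv])
  refine ⟨Ω, T, T', θ, jac, Finset.univ.sup fun c => (m c)⁻¹, fun c => ?_, hTm, hθm, fun c => ?_, fun c U g => ?_, hright, hlaw, hTo, hT'T, hmargin,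
    fun U hU c => ?_, hreg, fun c U => ?_, fun c U v => ?_, hToj, hregj, hsol, fun c U v hv => ?_⟩
  · -- hΩm (jointly): closed ball condition ∩ preimage of the open graph of `T` under `(U, g) ↦ (U, K_U g)`
    have h1 : MeasurableSet {p : GaugeField (F.P (j + 1)) 0 ↥(Matrix.specialUnitaryGroup (Fin 2) ℂ) × ↥(Matrix.specialUnitaryGroup (Fin 2) ℂ) |
        ‖((pre p.1 (bondShift (sitesPerDir_descend F j 0) c) * p.2 * post p.1 (bondShift (sitesPerDir_descend F j 0) c) : ↥(Matrix.specialUnitaryGroup (Fin 2) ℂ)) : Matrix (Fin 2) (Fin 2) ℂ) -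
          ((openHol p.1 (bondShift (sitesPerDir_descend F j 0) c) i₀ : ↥(Matrix.specialUnitaryGroup (Fin 2) ℂ)) : Matrix (Fin 2) (Fin 2) ℂ)‖ ≤ ρ} := by
      refine (isClosed_le ?_ continuous_const).measurableSet
      have hc := continuous_openHol_pre_post (bondShift (sitesPerDir_descend F j 0) c) i₀
      exact ((continuous_subtype_val.comp ((((hc.2.1.comp continuous_fst).mul continuous_snd).mul (hc.2.2.comp continuous_fst)))).sub
        (continuous_subtype_val.comp (hc.1.comp continuous_fst))).norm
    have h2 : MeasurableSet ((fun p : GaugeField (F.P (j + 1)) 0 ↥(Matrix.specialUnitaryGroup (Fin 2) ℂ) × ↥(Matrix.specialUnitaryGroup (Fin 2) ℂ) =>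
        (p.1, descend F ℰp j (update p.1 (centralBond (bondShift (sitesPerDir_descend F j 0) c)) p.2) c)) ⁻¹'
        {q : GaugeField (F.P (j + 1)) 0 ↥(Matrix.specialUnitaryGroup (Fin 2) ℂ) × ↥(Matrix.specialUnitaryGroup (Fin 2) ℂ) | q.2 ∈ T c q.1}) :=
      (hTm c).preimage (measurable_fst.prodMk (hψm c))
    have hset : {p : GaugeField (F.P (j + 1)) 0 ↥(Matrix.specialUnitaryGroup (Fin 2) ℂ) × ↥(Matrix.specialUnitaryGroup (Fin 2) ℂ) | p.2 ∈ Ω c p.1} =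
        {p : GaugeField (F.P (j + 1)) 0 ↥(Matrix.specialUnitaryGroup (Fin 2) ℂ) × ↥(Matrix.specialUnitaryGroup (Fin 2) ℂ) |
          ‖((pre p.1 (bondShift (sitesPerDir_descend F j 0) c) * p.2 * post p.1 (bondShift (sitesPerDir_descend F j 0) c) : ↥(Matrix.specialUnitaryGroup (Fin 2) ℂ)) : Matrix (Fin 2) (Fin 2) ℂ) -
            ((openHol p.1 (bondShift (sitesPerDir_descend F j 0) c) i₀ : ↥(Matrix.specialUnitaryGroup (Fin 2) ℂ)) : Matrix (Fin 2) (Fin 2) ℂ)‖ ≤ ρ} ∩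
        ((fun p : GaugeField (F.P (j + 1)) 0 ↥(Matrix.specialUnitaryGroup (Fin 2) ℂ) × ↥(Matrix.specialUnitaryGroup (Fin 2) ℂ) =>
          (p.1, descend F ℰp j (update p.1 (centralBond (bondShift (sitesPerDir_descend F j 0) c)) p.2) c)) ⁻¹'
          {q : GaugeField (F.P (j + 1)) 0 ↥(Matrix.specialUnitaryGroup (Fin 2) ℂ) × ↥(Matrix.specialUnitaryGroup (Fin 2) ℂ) | q.2 ∈ T c q.1}) :=
      Set.ext fun p => hΩ c p.1 p.2
    rw [hset]; exact h1.inter h2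
  · -- hjm
    have hJθ : Measurable fun p : GaugeField (F.P (j + 1)) 0 ↥(Matrix.specialUnitaryGroup (Fin 2) ℂ) × ↥(Matrix.specialUnitaryGroup (Fin 2) ℂ) =>
        (J (bondShift (sitesPerDir_descend F j 0) c) p.1 (θ c p.1 p.2))⁻¹ := ((hJm (bondShift (sitesPerDir_descend F j 0) c)).fun_comp (measurable_fst.prodMk (hθm c))).inv
    have hfun : (fun p : GaugeField (F.P (j + 1)) 0 ↥(Matrix.specialUnitaryGroup (Fin 2) ℂ) × ↥(Matrix.specialUnitaryGroup (Fin 2) ℂ) => jac c p.1 p.2) =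
        fun p => if p.2 ∈ T c p.1 then (J (bondShift (sitesPerDir_descend F j 0) c) p.1 (θ c p.1 p.2))⁻¹ else 0 := funext fun p => hjac c p.1 p.2
    rw [hfun]
    exact Measurable.ite (hTm c) hJθ measurable_const
  · -- hΩbl
    have hU' : ∀ b : PBond (F.P (j + 1)) 0, (¬ ∃ c' : PBond (F.P j) 0, centralBond (bondShift (sitesPerDir_descend F j 0) c') = b) →
        (extend (fun c : PBond (F.P j) 0 => centralBond (bondShift (sitesPerDir_descend F j 0) c)) g U : GaugeField (F.P (j + 1)) 0 ↥(Matrix.specialUnitaryGroup (Fin 2) ℂ)) b = U b :=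
      fun b hb => extend_apply' _ _ _ hb
    obtain ⟨hpre, hpost⟩ := pre_post_congr_off_private F j hU' c
    ext x
    rw [hΩ, hΩ, hpre, hpost, openHol_congr_off_private F j U _ c i₀ (hi₀ c) hU', descend_update_congr_off_private F j hU' c x, (hblind c U _ hU').1]
  · -- hΩS
    refine (hΩ c U _).2 ⟨?_, ?_⟩
    · rw [← axialAvg_eq_pre_mul_mul_post U (bondShift (sitesPerDir_descend F j 0) c), norm_sub_rev]
      exact ((small_is_good F j ha hU hta c i₀ i₀).2.1).trans htρ
    · rw [update_eq_self]
      exact subset_closure.trans (hT'T c U) (hsol U hU c).1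
  · -- hjc
    have hJθ : ContinuousOn (fun v => ((J (bondShift (sitesPerDir_descend F j 0) c) U (θ c U v) : ℝ≥0) : ℝ)) (T c U) :=
      NNReal.continuous_coe.comp_continuousOn (((hJc (bondShift (sitesPerDir_descend F j 0) c) U).comp (hreg c U) fun v hv => hwinθ c U v hv) )
    refine ((hJθ.inv₀ fun v hv => ?_).congr fun v hv => ?_)
    · exact_mod_cast hJ0 (bondShift (sitesPerDir_descend F j 0) c) U _ (hwinθ c U v hv)
    · rw [hjac, if_pos hv, NNReal.coe_inv]; rfl
  · -- hjM
    rw [hjac]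
    split_ifs with hv
    · have hmv : m c ≤ J (bondShift (sitesPerDir_descend F j 0) c) U (θ c U v) := hmle c U _ (hwinθ c U v hv)
      calc (J (bondShift (sitesPerDir_descend F j 0) c) U (θ c U v))⁻¹ ≤ (m c)⁻¹ := by
            rw [← NNReal.coe_le_coe, NNReal.coe_inv, NNReal.coe_inv]
            exact inv_anti₀ (by exact_mod_cast hm0 c) (by exact_mod_cast hmv)
        _ ≤ Finset.univ.sup fun c => (m c)⁻¹ := Finset.le_sup (f := fun c => (m c)⁻¹) (Finset.mem_univ c)
    · exact bot_le
  · -- hjpos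
    rw [hjac, if_pos hv]
    exact inv_ne_zero (hJ0 (bondShift (sitesPerDir_descend F j 0) c) U _ (hwinθ c U v hv))

end Summit.QuantumFields.YangMills.Theorems.FluctuationComparisonRegPrIntLOrganTangentOneBondLaw

end
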